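import Summits.QuantumFields.QCD.Theorems.PauliWegnerSeaFMClosureUnquenchedDefs
import Literature.Probability.LatticeModels.TorusCentredLift

/-!
# Crux `FMClosureUnquenched` (stmt-QuantumFields-11512), line `von-mises-circles`, stub `stub_closure`:
helper 3 — box geometry on the odd torus

Elementary membership, disjointness and cardinality facts for the side sets of the thick-collar bootstrap
(`ball`, `sphere`, `ebox`, `boxIn`, `boxOut` of `…FMClosureUnquenchedDefs`) on the torus of side `2S+1`, and
their relation to the torus sup-distance `Torus.tnorm` (centred lift, `TorusCentredLift`): faithfulness of
`w ↦ x + proj w` on offsets of size `≤ S`; `boxOut r ⊆ ebox (3r+2) \\ ebox r`, `boxIn (3ℓ+2) ⊆ ebox (3ℓ+2) \\ ebox ℓ`,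
`boxOut r ∩ ebox r = ∅`, `sphere (r+1) ∩ ball r = ∅`, `boxIn r ⊆ sphere r ∪ (ball r)ᶜ`; points at sup-distance
`> r + 1` lie outside `ebox r`; cardinalities `≤ (2r+1)^4, (2r+2)^4, (2r+4)^4`.

References: Aizenman–Schenker–Friedrich–Hundertmark, CMP 224 (2001) 219, §2 [AizenmanEtAl2001].
-/

noncomputable section

namespace Summit.QuantumFields.QCD.Theorems.VonMisesCirclesC1

open Finset Literature.Probability.LatticeModels Summit.QuantumFields.QCD.Theorems.VonMisesCircles

variable {S : ℕ}

/-! ## Faithfulness of the offset parametrisation -/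

/-- Two offsets with coordinates of absolute value `≤ S` and the same image on the torus of side `2S+1`
coincide. [folklore] -/
theorem c1_offset_inj {w w' : Site 4} (hw : ∀ j, -(S : ℤ) ≤ w j ∧ w j ≤ S)
    (hw' : ∀ j, -(S : ℤ) ≤ w' j ∧ w' j ≤ S) (x : TorusSite 4 (2 * S + 1))
    (h : x + Torus.proj (2 * S + 1) w = x + Torus.proj (2 * S + 1) w') : w = w' := by
  refine Torus.proj_injective_of_abs_sub_lt (fun j => ?_) (add_left_cancel h)
  have h1 := hw j
  have h2 := hw' j
  rw [abs_sub_lt_iff]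
  push_cast
  omega

/-! ## Membership -/

/-- Membership in the even box: `z = x + proj w`, `w ∈ {-r-1,…,r}⁴`. [folklore] -/
theorem c1_mem_ebox {x z : TorusSite 4 (2 * S + 1)} {r : ℕ} :
    z ∈ ebox S x r ↔ ∃ w : Site 4, (∀ i, -(r : ℤ) - 1 ≤ w i ∧ w i ≤ r) ∧ z = x + Torus.proj (2 * S + 1) w := by
  simp only [ebox, mem_image, Fintype.mem_piFinset, mem_Icc]
  exact ⟨fun ⟨w, hw, h⟩ => ⟨w, hw, h.symm⟩, fun ⟨w, hw, h⟩ => ⟨w, hw, h.symm⟩⟩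

/-- Membership in the inner boundary of the even box. [folklore] -/
theorem c1_mem_boxIn {x z : TorusSite 4 (2 * S + 1)} {r : ℕ} :
    z ∈ boxIn S x r ↔ ∃ w : Site 4, (∀ i, -(r : ℤ) - 1 ≤ w i ∧ w i ≤ r) ∧
      (∃ i, w i = -(r : ℤ) - 1 ∨ w i = r) ∧ z = x + Torus.proj (2 * S + 1) w := by
  simp only [boxIn, mem_image, mem_filter, Fintype.mem_piFinset, mem_Icc]
  exact ⟨fun ⟨w, ⟨hw, hb⟩, h⟩ => ⟨w, hw, hb, h.symm⟩, fun ⟨w, hw, hb, h⟩ => ⟨w, ⟨hw, hb⟩, h.symm⟩⟩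

/-- Membership in the outer boundary of the even box. [folklore] -/
theorem c1_mem_boxOut {x z : TorusSite 4 (2 * S + 1)} {r : ℕ} :
    z ∈ boxOut S x r ↔ ∃ w : Site 4, (∀ i, -(r : ℤ) - 2 ≤ w i ∧ w i ≤ r + 1) ∧
      (∃ i, w i = -(r : ℤ) - 2 ∨ w i = (r : ℤ) + 1) ∧ z = x + Torus.proj (2 * S + 1) w := by
  simp only [boxOut, mem_image, mem_filter, Fintype.mem_piFinset, mem_Icc]
  exact ⟨fun ⟨w, ⟨hw, hb⟩, h⟩ => ⟨w, hw, hb, h.symm⟩, fun ⟨w, hw, hb, h⟩ => ⟨w, ⟨hw, hb⟩, h.symm⟩⟩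

/-- Membership in the odd ball: `z = x + proj w`, `w ∈ box r`. [folklore] -/
theorem c1_mem_ball {x z : TorusSite 4 (2 * S + 1)} {r : ℕ} :
    z ∈ ball S x r ↔ ∃ w : Site 4, (∀ i, -(r : ℤ) ≤ w i ∧ w i ≤ r) ∧ z = x + Torus.proj (2 * S + 1) w := by
  simp only [ball, mem_image, mem_box]
  exact ⟨fun ⟨w, hw, h⟩ => ⟨w, hw, h.symm⟩, fun ⟨w, hw, h⟩ => ⟨w, hw, h.symm⟩⟩

/-- Membership in the sup-sphere: `z = x + proj w`, `w ∈ box r` with a coordinate `= ±r`. [folklore] -/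
theorem c1_mem_sphere {x z : TorusSite 4 (2 * S + 1)} {r : ℕ} :
    z ∈ sphere S x r ↔ ∃ w : Site 4, (∀ i, -(r : ℤ) ≤ w i ∧ w i ≤ r) ∧
      (∃ i, w i = (r : ℤ) ∨ w i = -(r : ℤ)) ∧ z = x + Torus.proj (2 * S + 1) w := by
  simp only [VonMisesCircles.sphere, mem_image, mem_filter, mem_box]
  exact ⟨fun ⟨w, ⟨hw, hb⟩, h⟩ => ⟨w, hw, hb, h.symm⟩, fun ⟨w, hw, hb, h⟩ => ⟨w, ⟨hw, hb⟩, h.symm⟩⟩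

/-! ## Inclusions and exclusions -/

/-- `boxIn r ⊆ ebox r`. [folklore] -/
theorem c1_boxIn_subset_ebox (x : TorusSite 4 (2 * S + 1)) (r : ℕ) : boxIn S x r ⊆ ebox S x r := by
  intro z hz
  obtain ⟨w, hw, -, rfl⟩ := c1_mem_boxIn.1 hz
  exact c1_mem_ebox.2 ⟨w, hw, rfl⟩

/-- `boxOut r ∩ ebox r = ∅` (`r + 2 ≤ S`). [folklore] -/
theorem c1_not_mem_ebox_of_mem_boxOut {x z : TorusSite 4 (2 * S + 1)} {r : ℕ} (hrS : r + 2 ≤ S)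
    (hz : z ∈ boxOut S x r) : z ∉ ebox S x r := by
  intro hz'
  obtain ⟨w, hw, ⟨i, hi⟩, rfl⟩ := c1_mem_boxOut.1 hz
  obtain ⟨w', hw', h⟩ := c1_mem_ebox.1 hz'
  have heq : w = w' := c1_offset_inj (fun j => by have := hw j; omega) (fun j => by have := hw' j; omega) x h
  subst heq
  have := hw' i
  omega

/-- `boxOut r ⊆ ebox (3r+2)`. [folklore] -/
theorem c1_mem_ebox_three_of_mem_boxOut {x z : TorusSite 4 (2 * S + 1)} {r : ℕ}
    (hz : z ∈ boxOut S x r) : z ∈ ebox S x (3 * r + 2) := by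
  obtain ⟨w, hw, -, rfl⟩ := c1_mem_boxOut.1 hz
  exact c1_mem_ebox.2 ⟨w, fun i => by have := hw i; push_cast; omega, rfl⟩

/-- `boxIn (3ℓ+2) ∩ ebox ℓ = ∅` (`1 ≤ ℓ`, `3ℓ + 3 ≤ S`). [folklore] -/
theorem c1_not_mem_ebox_of_mem_boxIn_three {x z : TorusSite 4 (2 * S + 1)} {ℓ : ℕ} (hℓ : 1 ≤ ℓ)
    (hS : 3 * ℓ + 3 ≤ S) (hz : z ∈ boxIn S x (3 * ℓ + 2)) : z ∉ ebox S x ℓ := by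
  intro hz'
  obtain ⟨w, hw, ⟨i, hi⟩, rfl⟩ := c1_mem_boxIn.1 hz
  obtain ⟨w', hw', h⟩ := c1_mem_ebox.1 hz'
  have heq : w = w' :=
    c1_offset_inj (fun j => by have := hw j; push_cast at this; omega)
      (fun j => by have := hw' j; omega) x h
  subst heq
  have := hw' i
  push_cast at hi
  omega

/-- `sphere (r+1) ∩ ball r = ∅` (`r + 1 ≤ S`). [folklore] -/
theorem c1_not_mem_ball_of_mem_sphere_succ {x z : TorusSite 4 (2 * S + 1)} {r : ℕ} (hrS : r + 1 ≤ S)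
    (hz : z ∈ sphere S x (r + 1)) : z ∉ ball S x r := by
  intro hz'
  obtain ⟨w, hw, ⟨i, hi⟩, rfl⟩ := c1_mem_sphere.1 hz
  obtain ⟨w', hw', h⟩ := c1_mem_ball.1 hz'
  have heq : w = w' :=
    c1_offset_inj (fun j => by have := hw j; push_cast at this; omega)
      (fun j => by have := hw' j; omega) x h
  subst heq
  have := hw' i
  push_cast at hi
  omega

/-- `boxOut r ∩ ball r = ∅` (`r + 2 ≤ S`). [folklore] -/
theorem c1_not_mem_ball_of_mem_boxOut {x z : TorusSite 4 (2 * S + 1)} {r : ℕ} (hrS : r + 2 ≤ S)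
    (hz : z ∈ boxOut S x r) : z ∉ ball S x r := by
  intro hz'
  obtain ⟨w, hw, ⟨i, hi⟩, rfl⟩ := c1_mem_boxOut.1 hz
  obtain ⟨w', hw', h⟩ := c1_mem_ball.1 hz'
  have heq : w = w' := c1_offset_inj (fun j => by have := hw j; omega) (fun j => by have := hw' j; omega) x h
  subst heq
  have := hw' i
  omega

/-- `boxIn r ⊆ sphere r ∪ (ball r)ᶜ` (`r + 1 ≤ S`). [folklore] -/
theorem c1_mem_sphere_or_not_mem_ball_of_mem_boxIn {x z : TorusSite 4 (2 * S + 1)} {r : ℕ} (hrS : r + 1 ≤ S)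
    (hz : z ∈ boxIn S x r) : z ∈ sphere S x r ∨ z ∉ ball S x r := by
  obtain ⟨w, hw, ⟨i, hi⟩, rfl⟩ := c1_mem_boxIn.1 hz
  by_cases hall : ∀ j, -(r : ℤ) ≤ w j
  · exact Or.inl (c1_mem_sphere.2 ⟨w, fun j => ⟨hall j, (hw j).2⟩, ⟨i, by have := hall i; omega⟩, rfl⟩)
  · right
    intro hz'
    obtain ⟨w', hw', h⟩ := c1_mem_ball.1 hz'
    have heq : w = w' := c1_offset_inj (fun j => by have := hw j; omega) (fun j => by have := hw' j; omega) x h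
    subst heq
    exact hall fun j => (hw' j).1

/-- A point of `sphere r` is `x + proj w` for an offset `w ∈ box r` of sup norm exactly `r`. [folklore] -/
theorem c1_exists_offset_of_mem_sphere {x z : TorusSite 4 (2 * S + 1)} {r : ℕ} (hz : z ∈ sphere S x r) :
    ∃ w : Site 4, w ∈ box 4 r ∧ ‖w‖ = (r : ℝ) ∧ z = x + Torus.proj (2 * S + 1) w := by
  obtain ⟨w, hw, ⟨i, hi⟩, rfl⟩ := c1_mem_sphere.1 hz
  refine ⟨w, mem_box.2 hw, ?_, rfl⟩
  rw [Site.norm_eq_supNorm]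
  norm_cast
  apply le_antisymm
  · exact Site.supNorm_le_iff.2 fun j => by have := hw j; omega
  · have h1 := Site.natAbs_le_supNorm w i
    have h2 : (w i).natAbs = r := by omega
    omega

/-- Offsets `v ∈ box S` of sup norm `> r` project outside `ball r` (`r ≤ S`). [folklore] -/
theorem c1_not_mem_ball_of_supNorm_lt {x : TorusSite 4 (2 * S + 1)} {v : Site 4} {r : ℕ} (hv : v ∈ box 4 S)
    (hrS : r ≤ S) (hr : r < Site.supNorm v) : x + Torus.proj (2 * S + 1) v ∉ ball S x r := by
  intro h
  obtain ⟨w, hw, h⟩ := c1_mem_ball.1 h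
  rw [mem_box] at hv
  have heq : v = w := c1_offset_inj hv (fun j => by have := hw j; omega) x h
  subst heq
  have : Site.supNorm v ≤ r := Site.supNorm_le_iff.2 fun j => by have := hw j; omega
  omega

/-- Offsets `v ∈ box S` of sup norm `> r + 1` project outside `ebox r` (`r + 1 ≤ S`). [folklore] -/
theorem c1_not_mem_ebox_of_supNorm_lt {x : TorusSite 4 (2 * S + 1)} {v : Site 4} {r : ℕ} (hv : v ∈ box 4 S)
    (hrS : r + 1 ≤ S) (hr : r + 1 < Site.supNorm v) : x + Torus.proj (2 * S + 1) v ∉ ebox S x r := by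
  intro h
  obtain ⟨w, hw, h⟩ := c1_mem_ebox.1 h
  rw [mem_box] at hv
  have heq : v = w := c1_offset_inj hv (fun j => by have := hw j; omega) x h
  subst heq
  have : Site.supNorm v ≤ r + 1 := Site.supNorm_le_iff.2 fun j => by have := hw j; omega
  omega

/-- `boxIn r` and `boxOut r` are disjoint (`r + 2 ≤ S`). [folklore] -/
theorem c1_disjoint_boxIn_boxOut (x : TorusSite 4 (2 * S + 1)) {r : ℕ} (hrS : r + 2 ≤ S) :
    Disjoint (boxIn S x r) (boxOut S x r) :=
  Finset.disjoint_left.2 fun _ hz hz' => c1_not_mem_ebox_of_mem_boxOut hrS hz' (c1_boxIn_subset_ebox x r hz)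

/-! ## Torus distance -/

/-- The torus sup-distance of the projection of `v ∈ box S` is `‖v‖_∞`. [folklore] -/
theorem c1_tnorm_proj_of_mem_box {v : Site 4} (hv : v ∈ box 4 S) :
    Torus.tnorm (Torus.proj (2 * S + 1) v) = Site.supNorm v := by
  rw [Torus.tnorm, Torus.cRep_proj_of_mem_box (by omega) hv]

/-- `‖v‖ = ‖v‖_∞` as a real number. [folklore] -/
theorem c1_norm_eq_supNorm (v : Site 4) : ‖v‖ = (Site.supNorm v : ℝ) := Site.norm_eq_supNorm v

/-- Points of `boxIn r ∪ boxOut r` about `0` are at torus distance `≤ r + 2`. [folklore] -/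
theorem c1_tnorm_le_of_mem_boxIn_union_boxOut {z : TorusSite 4 (2 * S + 1)} {r : ℕ}
    (hz : z ∈ boxIn S 0 r ∪ boxOut S 0 r) : Torus.tnorm z ≤ r + 2 := by
  rcases mem_union.1 hz with h | h
  · obtain ⟨w, hw, -, rfl⟩ := c1_mem_boxIn.1 h
    rw [zero_add]
    refine (Torus.tnorm_proj_le w).trans (Site.supNorm_le_iff.2 fun j => ?_)
    have := hw j; omega
  · obtain ⟨w, hw, -, rfl⟩ := c1_mem_boxOut.1 h
    rw [zero_add]
    refine (Torus.tnorm_proj_le w).trans (Site.supNorm_le_iff.2 fun j => ?_)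
    have := hw j; omega

/-- Every torus point at distance `> r + 1` from `0` lies outside `ebox r` about `0` (`r + 1 ≤ S`). [folklore] -/
theorem c1_not_mem_ebox_of_tnorm_lt {y : TorusSite 4 (2 * S + 1)} {r : ℕ} (hrS : r + 1 ≤ S)
    (hy : r + 1 < Torus.tnorm y) : y ∉ ebox S 0 r := by
  have hrep : y = 0 + Torus.proj (2 * S + 1) (Torus.cRep y) := by rw [zero_add, Torus.proj_cRep]
  have hbox : Torus.cRep y ∈ box 4 S := by
    rw [Torus.cRep_mem_box_iff]
    -- `tnorm y ≤ S`: the centred representative has coordinates of absolute value `≤ S`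
    refine Site.supNorm_le_iff.2 fun j => ?_
    have := Torus.two_mul_natAbs_cRepZ_le (L := 2 * S + 1) (y j)
    change 2 * (Torus.cRep y j).natAbs ≤ 2 * S + 1 at this
    omega
  rw [hrep]
  exact c1_not_mem_ebox_of_supNorm_lt hbox hrS hy

/-- The torus distance is a torus norm: `tnorm y ≤ tnorm (y - z) + tnorm z`. [folklore] -/
theorem c1_tnorm_le_tnorm_sub_add (y z : TorusSite 4 (2 * S + 1)) :
    Torus.tnorm y ≤ Torus.tnorm (y - z) + Torus.tnorm z := by
  have h := Torus.tnorm_add_le (y - z) z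
  rwa [sub_add_cancel] at h

/-! ## Cardinalities -/

/-- `|sphere r| ≤ (2r+1)^4`. [folklore] -/
theorem c1_card_sphere_le (x : TorusSite 4 (2 * S + 1)) (r : ℕ) : (sphere S x r).card ≤ (2 * r + 1) ^ 4 := by
  refine card_image_le.trans ((card_filter_le _ _).trans ?_)
  rw [card_box]

/-- `|boxIn r| ≤ (2r+2)^4`. [folklore] -/
theorem c1_card_boxIn_le (x : TorusSite 4 (2 * S + 1)) (r : ℕ) : (boxIn S x r).card ≤ (2 * r + 2) ^ 4 := by
  refine card_image_le.trans ((card_filter_le _ _).trans ?_)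
  rw [Fintype.card_piFinset, prod_const, card_univ, Fintype.card_fin, Int.card_Icc]
  apply Nat.pow_le_pow_left
  omega

/-- `|boxOut r| ≤ (2r+4)^4`. [folklore] -/
theorem c1_card_boxOut_le (x : TorusSite 4 (2 * S + 1)) (r : ℕ) : (boxOut S x r).card ≤ (2 * r + 4) ^ 4 := by
  refine card_image_le.trans ((card_filter_le _ _).trans ?_)
  rw [Fintype.card_piFinset, prod_const, card_univ, Fintype.card_fin, Int.card_Icc]
  apply Nat.pow_le_pow_left
  omega

/-- **Registered helper `c1_closure_aux3` of crux stmt-QuantumFields-11512** (line `von-mises-circles`, stub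
`stub_closure`): torus points at sup-distance `> r + 1` from the centre lie outside the even box of radius `r`.
[folklore] -/
theorem c1_closure_aux3 : ∀ (S r : ℕ) (y : TorusSite 4 (2 * S + 1)), r + 1 ≤ S → r + 1 < Torus.tnorm y → y ∉ ebox S 0 r :=
  fun _ _ _ h1 h2 => c1_not_mem_ebox_of_tnorm_lt h1 h2

end Summit.QuantumFields.QCD.Theorems.VonMisesCirclesC1
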